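import Mathlib
import HarnessLib
import HarnessLib.Audit
import Summits.ABC.Statement
import Literature.NumberTheory.EllipticCurves.Szpiro
import Literature.NumberTheory.DiophantineGeometry.Conductor
import Literature.NumberTheory.DiophantineGeometry.MinimalDiscriminant
import HarnessLib.Audit.Status.Attr

/-!
Route: RationalCuspPencil

# Route RationalCuspPencil — Szpiro exponent 1/k from k rational cusps — the modular-unit pencil
dictionary (six-torsion ↦ 1/4)

X = SixTorsionClassEpsShape ∧ SixTorsionResidual ("it suffices to show"). SixTorsionClassEpsShape
(THE CLASS THEOREM, unconditional
target): for every ε > 0 there is C such that every elliptic curve E/ℚ with a rational point of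
order six — in Kubert's Tate normal
form W(u,w) = ⟨w−u, −u(u+w), −uw(u+w), 0, 0⟩, gcd(u,w) = 1, u w (u+w)(9u+w) ≠ 0 — satisfies
log|Δ_min(E)| ≤ C·N_E^(1/4+ε).
SixTorsionResidual (DECLARED RESIDUAL, never claimed): abc off the class theorem. DICTIONARY
(explicit, checkable): a genus-0 modular
curve X_Γ/ℚ with k RATIONAL CUSPS c_1..c_k; E with Γ-structure ↦ t = u/w ∈ ℙ¹(ℚ); cusp ↦ primitive
linear form x_l = a_l u + b_l w;
(D1) Δ(W(u,w)) = ∏ x_l^{m_l} exactly (here u⁶w²(u+w)³(9u+w)); (D2) p ≥ 5, p | x_l ⇒ p ∤ c₄ ⇒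
multiplicative, f_p = 1 ⇒ rad(∏x_l) | 6·N_E;
(D3) every x_l lies in a three-term sub-pencil identity a_l·u + b_l·w = x_l with two other cusp
forms (u, w are cusps) — an S-unit
equation over the FIXED field ℚ whose radical is charged to N_E. Card realised:
rational-cusp-pencil. HONESTY: no summit is proved by
this line; the class theorem is NOT abc, NOT A-PS (POLY-SZPIRO(E)), NOT rung A1′; typed ≠ proved;
computed ≠ proved; the residual is abc.
Lean: `SixTorsionClassEpsShape ∧ (SixTorsionClassEpsShape → _root_.ABC)`

## Assembly
Pure logic: closes (h₁ : PencilFourBound) (h₂ : SixTorsionDictionary) (h₃ : SixTorsionPayoff) (h₄ :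
SixTorsionResidual) : _root_.ABC :=
h₄ (h₃ h₁ h₂). The class theorem SixTorsionClassEpsShape = h₃ h₁ h₂ is the unconditional content; h₄
is the declared residual.

Rationale: WHY THIS LINE. Mechanism: on a modular family the CUSPS ARE FORCED BAD PRIMES (v_p(j) < 0 ⇒
potentially multiplicative ⇒ p | N), so the k cusp
forms of the Hauptmodul pencil are S-units for S = primes of N; each cusp form x_l sits in a 3-term
identity with two others, and
Stewart–Yu 2001 Theorem 2 (StewartYu2001; PROVED in the tree:
Summit.ABC.ABC.Theorems.stewartYu2001_thm2_holds, ε-form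
StewartYu2001.log_lt_const_mul_pmin_mul_rpow) bounds log H(t) by K·P(x_l)·R^ε for EVERY member l,
hence by K·min_l P(x_l)·R^ε ≤
K'·R^(1/k+ε) (a prime above the pencil's resultants divides at most one member, so min^k ≤ ∏_l
P(x_l) ≤ c·R — the k-member version of
the tree's StewartYu2001.pmin_pow_three_le_rad, Sheppard2016 §2.4). With k = 3 (Legendre family X(2)
= Frey curves) this is the folklore
Szpiro exponent 1/3 on Frey curves (tree: epsShapeBound_third_holds); the NEW lever is that k =
#rational cusps drives the exponent:
k = 4 for a rational point of order 6, 8, 10 (Kubert1976 Table 3; cusp counts job j296214), k = 6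
for order 12 (via the s = t² − t pencil)
and for ℤ/2×ℤ/6, giving exponents 1/4 and 1/6 for ALL curves of those classes, where print has only
the all-curves record 1+ε
(MurtyPasten2013), the Frey-locus 1/3, density statements (arXiv:2407.13850 Thm 1.4: almost all
curves with torsion G have Szpiro
ratio ≈ β_G) and LOWER bounds by torsion (arXiv:2104.10817). Imported areas: modular units / Tate
normal forms (arithmetic of modular
curves) ↦ S-unit equations (Baker's method, EvertseGyory2015 ch. 4–6, GyoryYu2006), with the
explicit dictionary (D1)–(D3); local data of
the Kubert families as in arXiv:2001.01016. Versus listed routes: GaussianTwoDivision /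
AntisymmetricTwoTorsion (one 2-torsion point,
unit equation over ℚ(i) resp. a rad(a)-free engine, exponent 2/3 resp. subexp-up-to-defect) use the
2-DIVISION FIELD; this line stays
over ℚ and uses the CUSP COUNT; PadicPrimesKummerThird / StewartYu rungs are all-triples abc-side
ε-shapes (exponent ≥ 1/3 by
BakerMethodBoundsEpsShape); no listed route uses modular units or torsion/isogeny level structure as
the dictionary.

RANKED CRUXES. #0 SixTorsionClassEpsShape (target) — Szpiro's conjecture in ε-shape with exponent
1/4 for every elliptic curve over ℚ with a rational point of order six, stated on Kubert's integral
Tate normal form W(u,w) = ⟨w−u, −u(u+w), −uw(u+w), 0, 0⟩ (every such curve is ℚ-isomorphic to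
exactly one W(u,w), Kubert1976 Table 3; this identification is semantic and not load-bearing). (why
it might fail: only through the two items below: a cusp prime p ≥ 5 at which the Kubert model were
non-minimal or additive (excluded: c₄ takes the values 1, 16, 144, 9u⁴ on the four cusp lines), or a
mis-normalised sub-triple in the pencil engine.) [Kubert1976, StewartYu2001, arXiv:2001.01016,
arXiv:2407.13850]
#2 PencilFourBound (crux) — THE PENCIL ENGINE (k = 4, abc side, integers only): for fixed nonzero
integers a₃, b₃, a₄, b₄ with a₃b₄ ≠ a₄b₃ and every ε > 0 there is C with log max(|u|,|w|) ≤
C·rad(u·w·(a₃u+b₃w)·(a₄u+b₄w))^(1/4+ε) for all coprime u, w with u w (a₃u+b₃w)(a₄u+b₄w) ≠ 0 (card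
item K1). Serves ℤ/6 (forms u, w, u+w, 9u+w), ℤ/8 and ℤ/10 (u, w, u−w, 2u−w), ℤ/2×ℤ/4 (u, w, 4u−w,
4u+w), ℤ/2×ℤ/8 (u, w, 2u+w, 4u+w). [difficulty: M] (why it might fail: Low risk (corollary of the
PROVED Thm 2): the sub-triples (a₃u, b₃w, a₃u+b₃w)/gcd must be re-normalised to coprime positive
x+y=z with z>2; P of a scaled member is ≤ P(a₃b₃)·P(x_l), not ≤ P(x_l) — constants, not the
exponent, absorb this.) [StewartYu2001, Sheppard2016, GyoryYu2006, EvertseGyory2015]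
#3 SixTorsionResidual (crux) — DECLARED RESIDUAL (never claimed, exempt from staffing credit): the
abc conjecture, given the six-torsion class theorem — i.e. abc off the class. Booked so that the
deciding theorem reaches the Statement decl; to be narrowed to the ε-column rung for elliptic curves
(SzpiroExponentBelowOne / SzpiroEpsShape (1/4)) off the class once that rung is a registered closer.
[deps: SixTorsionClassEpsShape] [difficulty: open-problem] (why it might fail: It is abc itself
modulo a provable class lemma: every catalogued barrier (BakerMethodBounds, EpsilonCannotBeDropped)
stands in front of it; honest label RESIDUAL = the summit, open.) [MurtyPasten2013, StewartYu2001]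
#9 SixTorsionDictionary (support) — THE SIX-TORSION DICTIONARY (Tate's algorithm away from 6 on the
Kubert model): for coprime u, w with u w (u+w)(9u+w) ≠ 0 and W = W(u,w) elliptic, |Δ_min(W)| ≤ |u⁶
w² (u+w)³ (9u+w)| (= |Δ| of the integral model, exact identity checked in PARI, job j296255) and
rad(u w (u+w)(9u+w)) ∣ 6·N_W (at p ≥ 5 dividing a cusp form, p ∤ c₄ = 9u⁴+12u³w+30u²w²+12uw³+w⁴
since c₄ ≡ w⁴, 16w⁴·unit, 144·unit, 9u⁴ on the lines u, u+w, 9u+w, w = 0; so the model is minimal at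
p with multiplicative reduction, f_p = 1 — tree lemma
WeierstrassCurve.conductorExponent_eq_one_of_dvd_Δ_of_not_dvd_c₄, pattern of
Summit.ABC.ABC.Theorems.twoTorsionDictionary_proof). [difficulty: provable-now] [SilvermanAEC2009,
Kubert1976, arXiv:2001.01016]
#9 SixTorsionPayoff (support) — PAYOFF (real-analysis glue): the pencil engine with (a₃,b₃,a₄,b₄) =
(1,1,9,1) and the dictionary give the class theorem: log|Δ_min| ≤ 12·log max(|u|,|w|) + log 10·… ≤
12·C·(6 N_W)^(1/4+ε) + c ≤ C'·N_W^(1/4+ε) (N_W ≥ 1). [difficulty: provable-now] [StewartYu2001,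
SilvermanAEC2009]

TWO-LAYER PLAN. Foreseen once PencilFourBound closes: (i) the k = 6 pencil PencilSixBound (six fixed
members of a binary pencil ⇒ exponent 1/6) with the
TWELVE-TORSION dictionary (s = t² − t; forms σ = u(u−w), τ = w², 4σ+τ, 2σ+τ, 3σ+τ, 6σ+τ, all
dividing Δ of Kubert's ℤ/12 model;
sample (u,w) = (3,1): N = 2·3·5·13·19·37 = product of the six forms' primes, job j296255) and the
ℤ/2×ℤ/6 dictionary (forms w, u−w, u−3w,
u+3w, u−5w, u−9w) ⇒ Szpiro exponent 1/6 on those classes — filed as a sub-route (LINE g4-2); (ii)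
ℤ/7 and ℤ/9 (k = 3: forms u, w, u−w)
⇒ exponent 1/3 on classes WITHOUT rational 2-torsion (ties the Frey record off the Frey locus);
(iii) the isogeny classes X₀(N),
N ∈ {6, 8, 10, 12, 16, 18} (rational cusps = #{d | N : gcd(d, N/d) ≤ 2} = 4, 4, 4, 6, 4, 4) need the
Hauptmodul j-maps typed — later.
Split foreseen for PencilFourBound: PerTermBound → PminLeRadFourth → PencilFourBound (BC3 skeleton
bc/PencilFourBound_birth.lean,
composition kernel-checked).

KILL CRITERIA. A kernel refutation of PencilFourBound (impossible unless mis-typed: it follows from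
the proved stewartYu2001_thm2) or of
SixTorsionDictionary (a cusp prime p ≥ 5 with f_p ≠ 1 on the Kubert model — excluded by the c₄
values; a refuter checks one curve)
closes the route refuted:<Decl>. A proof elsewhere of SzpiroEpsShape (1/4) for all E/ℚ (rung
A1e-column) moots the class theorem;
abc moots everything. The residual is never a kill criterion (declared).

NOT DECOMPOSED YET. The per-member normalisation constants (gcd(a₃u, b₃w) | a₃b₃, signs, the z > 2
threshold), the prime-2,3 bookkeeping of the
dictionary (absorbed in the factor 6), and the k = 6 / X₀(N) instances — layer-2 children or the
sub-route, later.

CHEAPEST FALSIFIER. One PARI line per class member: for coprime (u,w) in a box, check N_W against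
rad(u w (u+w)(9u+w)) (must agree away from 2, 3) and
elltors = ℤ/6. RUN (job j296255): (u,w) = (2,1): torsion [6], N = 114 = 2·3·19 = rad(2·1·3·19) ✓,
Δ_min = Δ_model = 32832 = 2⁶·3³·19 ✓;
(7,3): torsion [6], N = 2²·3²·5·7·11, Δ_min = 2⁴3³5³7⁶11 = 7⁶·3²·10³·66 ✓ (forms 7, 3, 10, 66). The
instrument row that would refute
the key lemma: a coprime (u,w) and a prime p ≥ 5 with p | u w (u+w)(9u+w) but p ∤ N_W — none exists
by (D2); ENG can scan |u|,|w| ≤ 10⁴.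

NUMBERS. All-curves record: log|Δ_min| ≪_ε N^(1+ε) (MurtyPasten2013; StewartYu2001 Thm 1 gives
exponent 1/3 only for abc triples = Frey
curves). Typical value: Szpiro ratio ≈ 3 for almost all ℤ/6-curves (arXiv:2407.13850 Thm 1.4, β_{C6}
= 3), lower bounds by torsion
(arXiv:2104.10817). This line: worst-case exponent 1/4 (ℤ/6, ℤ/8, ℤ/10, ℤ/2×ℤ/4, ℤ/2×ℤ/8), 1/6
(ℤ/12, ℤ/2×ℤ/6), 1/3 (ℤ/4, ℤ/7, ℤ/9);
rational cusp counts k from job j296214 (ℤ/5: k = 2, no statement).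

DEFINITION REQUESTS. None: WeierstrassCurve.minimalDiscriminantNorm / conductorNorm
(Literature.NumberTheory.DiophantineGeometry), UniqueFactorizationMonoid.radical,
Literature.Barriers.ABC.largestPrimeFactor all exist.

Novelty: Searches (2026-08-28): lit search "Barrios minimal discriminants rational elliptic curves torsion"
(local 1, crossref 8: arXiv:2001.01016, doi:10.2140/pjm.2022.318.1); lit search "modified Szpiro
ratio torsion lower bounds" (local 3: arXiv:2104.10817, arXiv:2407.13850, arXiv:2204.10950); lit
search --hybrid "Szpiro conjecture elliptic curves rational torsion point of order six exponent" (6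
books, none on point: Silverman ATAEC p.365, BG2006 p.418); earlier this session: lit search "Szpiro
torsion" (zbMATH 25 rows, none relevant), "unit equation modular curve cusps effective Siegel"
(zbMATH 0), corpus [corpus:book:evertse2015-unit-equations-diophantine-number-theory p.88]
(effective weak abc list: Stewart–Tijdeman, Stewart–Yu 1991/2001, Győry–Yu 2006, Surroca 2007, Győry
2008 — all all-triples), lit galaxy search "Szpiro|torsion point" / "modular unit|S-unit" --star all
(substring junk, 0 relevant); OpenAlex/S2 HTTP 429 (not dialled); lean search / rg over Theses: no
route uses modular units, cusps-as-S-units or torsion level structure (CMRescueSzpiro uses X_split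
Runge, different).
Nearest prior art found: StewartYu2001 Thm 2 + remark (p′ ≤ G^(1/3): the k = 3 case, tree
pmin_pow_three_le_rad); arXiv:2407.13850 (Chan 2024, Thm 1.4: ALMOST ALL curves with torsion G have
Szpiro ratio ≈ β_G — density, not worst case); arXiv:2104.10817 (Barrios 2023: LOWER bounds for the
modified Szpiro ratio by torsion); arXiv:2001.01016 (Barrios 2022: minimal models / local data of
the Kubert fa  [refs: 10.2140/pjm.2022.318.1, 2001.01016, 2104.10817, 2407.13850, 2204.10950, doi:10.2140/pjm.2022.318.1, book:evertse2015-unit-equations-diophantine-number-theory, StewartYu2001, GyoryYu2006]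

Barriers (technique_class: dictionary-import, baker-lfl, modular-units): - technique_class: dictionary-import, baker-lfl, modular-units
- Literature.Barriers.ABC.BakerMethodBounds: INSIDE the class (the engine is Stewart–Yu's
linear-forms-in-logarithms product) and it does not beat it: the all-triples ceiling
exp(κ·rad^(1/3)(log rad)³) (stewart_yu) is respected; the exponent drops to 1/k only because the
radical of k − 3 FURTHER pencil members is charged — a locus statement the barrier (which quantifies
over all abc triples with rad(abc) alone) does not cover; the EpsShapeBound θ family of the same
barrier file set (BakerMethodBoundsEpsShape.lean) likewise concerns all triples.
- Literature.Barriers.ABC.EpsilonCannotBeDropped: the class theorem keeps +ε in the exponent and a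
constant C(ε); the Szpiro-side ε-witnesses likewise (no ε-free claim is made).
- Literature.Barriers.ABC.BakerShapeConstantFloor: not engaged (no claim on Baker-shape constants;
ground field ℚ fixed, no field-uniformity claimed — this is exactly how the line evades the g0–g2
wall B-LFL×DIVFIELD (regulator/degree growth of ℚ(E[2])): the S-unit equation lives over ℚ).
- Literature.Barriers.ABC.ExplicitABCQualityFloor: not engaged; HallExponentSharp /
NConjectureExponentSharp likewise (no quality < 1 or Hall-type claim; statements are ≪_ε with
unspecified constants).
- Negatives index: steers around every refuted ABC statement at filing (ledger negatives --problem
ABC: the refuted items are spectral/Parseval positivity (B-INT×POS), exponent-free or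
uniform-constant claims and Eps

sub-problem: ABC · status: draft · opened planner-abc-idea-1-g4-0 2026-08-28T01:51:07Z · rev 0 · ledger route-ABC-RationalCuspPencil
GENERATED by the gate from the ledger (D-0016/17). Provers cite these decls: `theorem foo : Summit.ABC.ABC.Theses.RationalCuspPencil.<Decl> := …` in Summits/ABC/ABC/Theorems/<Name>.lean.
-/

namespace Summit.ABC.ABC.Theses.RationalCuspPencil

open scoped BigOperators Topology Manifold Classical MeasureTheory ProbabilityTheory Matrix InnerProductSpace ComplexConjugate ContinuousMap
open Filter Set Function TopologicalSpace MeasureTheory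

attribute [summit_statement] _root_.ABC

open Literature.Abc

/-- item stmt-ABC-24548 · target · rank 0 · closed · proved by Summit.ABC.ABC.Theorems.sixTorsionClassEpsShape_proof (prover) · by planner
why it might fail: only through the two items below: a cusp prime p ≥ 5 at which the Kubert model were non-minimal or additive (excluded: c₄ takes the values 1, 16, 144, 9u⁴ on the four cusp lines), or a mis-normalised sub-triple in the pencil engine.
sources: Kubert1976, StewartYu2001, arXiv:2001.01016, arXiv:2407.13850
[target] Szpiro's conjecture in ε-shape with exponent 1/4 for every elliptic curve over ℚ with a
rational point of order six, stated on Kubert's integral Tate normal form W(u,w) = ⟨w−u, −u(u+w),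
−uw(u+w), 0, 0⟩ (every such curve is ℚ-isomorphic to exactly one W(u,w), Kubert1976 Table 3; this
identification is semantic and not load-bearing). -/
@[route_item "route-ABC-RationalCuspPencil"]
def SixTorsionClassEpsShape : Prop :=
  ∀ ε : ℝ, 0 < ε → ∃ C : ℝ, ∀ u w : ℤ, IsCoprime u w → u * w * (u + w) * (9 * u + w) ≠ 0 → ∀ (W : WeierstrassCurve ℚ) [W.IsElliptic], W = ⟨((w - u : ℤ) : ℚ), ((-(u * (u + w)) : ℤ) : ℚ), ((-(u * w * (u + w)) : ℤ) : ℚ), 0, 0⟩ → Real.log (W.minimalDiscriminantNorm ℤ : ℝ) ≤ C * (W.conductorNorm ℤ : ℝ) ^ (1 / 4 + ε : ℝ)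

-- `SixTorsionClassEpsShape` holds: proved by `Summit.ABC.ABC.Theorems.sixTorsionClassEpsShape_proof` (its module imports this route file, so no `_holds` link can be stated here).

/-- item stmt-ABC-24549 · crux · rank 2 · closed · proved by Summit.ABC.ABC.Theorems.pencilFourBound_proof (prover) · by planner
why it might fail: Low risk (corollary of the PROVED Thm 2): the sub-triples (a₃u, b₃w, a₃u+b₃w)/gcd must be re-normalised to coprime positive x+y=z with z>2; P of a scaled member is ≤ P(a₃b₃)·P(x_l), not ≤ P(x_l) — constants, not the exponent, absorb this.
sources: StewartYu2001, Sheppard2016, GyoryYu2006, EvertseGyory2015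
[crux] THE PENCIL ENGINE (k = 4, abc side, integers only): for fixed nonzero integers a₃, b₃, a₄, b₄
with a₃b₄ ≠ a₄b₃ and every ε > 0 there is C with log max(|u|,|w|) ≤
C·rad(u·w·(a₃u+b₃w)·(a₄u+b₄w))^(1/4+ε) for all coprime u, w with u w (a₃u+b₃w)(a₄u+b₄w) ≠ 0 (card
item K1). Serves ℤ/6 (forms u, w, u+w, 9u+w), ℤ/8 and ℤ/10 (u, w, u−w, 2u−w), ℤ/2×ℤ/4 (u, w, 4u−w,
4u+w), ℤ/2×ℤ/8 (u, w, 2u+w, 4u+w). [difficulty: M] -/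
@[route_item "route-ABC-RationalCuspPencil", crux]
def PencilFourBound : Prop :=
  ∀ a₃ b₃ a₄ b₄ : ℤ, a₃ ≠ 0 → b₃ ≠ 0 → a₄ ≠ 0 → b₄ ≠ 0 → a₃ * b₄ ≠ a₄ * b₃ → ∀ ε : ℝ, 0 < ε → ∃ C : ℝ, ∀ u w : ℤ, IsCoprime u w → u * w * (a₃ * u + b₃ * w) * (a₄ * u + b₄ * w) ≠ 0 → Real.log ((max |u| |w| : ℤ) : ℝ) ≤ C * (((UniqueFactorizationMonoid.radical (u * w * (a₃ * u + b₃ * w) * (a₄ * u + b₄ * w))).natAbs : ℕ) : ℝ) ^ (1 / 4 + ε : ℝ)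

-- `PencilFourBound` holds: proved by `Summit.ABC.ABC.Theorems.pencilFourBound_proof` (its module imports this route file, so no `_holds` link can be stated here).

/-- item stmt-ABC-24550 · crux · rank 3 · open · by planner
why it might fail: It is abc itself modulo a provable class lemma: every catalogued barrier (BakerMethodBounds, EpsilonCannotBeDropped) stands in front of it; honest label RESIDUAL = the summit, open.
sources: MurtyPasten2013, StewartYu2001
[crux] DECLARED RESIDUAL (never claimed, exempt from staffing credit): the abc conjecture, given the
six-torsion class theorem — i.e. abc off the class. Booked so that the deciding theorem reaches the
Statement decl; to be narrowed to the ε-column rung for elliptic curves (SzpiroExponentBelowOne /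
SzpiroEpsShape (1/4)) off the class once that rung is a registered closer. [deps:
SixTorsionClassEpsShape] [difficulty: open-problem] -/
@[route_item "route-ABC-RationalCuspPencil", crux]
def SixTorsionResidual : Prop :=
  SixTorsionClassEpsShape → _root_.ABC

/-- item stmt-ABC-24551 · support · rank 9 · closed · proved by Summit.ABC.ABC.Theorems.sixTorsionDictionary_proof (prover) · by planner
sources: SilvermanAEC2009, Kubert1976, arXiv:2001.01016
[support] THE SIX-TORSION DICTIONARY (Tate's algorithm away from 6 on the Kubert model): for coprime
u, w with u w (u+w)(9u+w) ≠ 0 and W = W(u,w) elliptic, |Δ_min(W)| ≤ |u⁶ w² (u+w)³ (9u+w)| (= |Δ| of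
the integral model, exact identity checked in PARI, job j296255) and rad(u w (u+w)(9u+w)) ∣ 6·N_W
(at p ≥ 5 dividing a cusp form, p ∤ c₄ = 9u⁴+12u³w+30u²w²+12uw³+w⁴ since c₄ ≡ w⁴, 16w⁴·unit,
144·unit, 9u⁴ on the lines u, u+w, 9u+w, w = 0; so the model is minimal at p with multiplicative
reduction, f_p = 1 — tree lemma WeierstrassCurve.conductorExponent_eq_one_of_dvd_Δ_of_not_dvd_c₄,
pattern of Summit.ABC.ABC.Theorems.twoTorsionDictionary_proof). [difficulty: provable-now] -/
@[route_item "route-ABC-RationalCuspPencil", crux]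
def SixTorsionDictionary : Prop :=
  ∀ u w : ℤ, IsCoprime u w → u * w * (u + w) * (9 * u + w) ≠ 0 → ∀ (W : WeierstrassCurve ℚ) [W.IsElliptic], W = ⟨((w - u : ℤ) : ℚ), ((-(u * (u + w)) : ℤ) : ℚ), ((-(u * w * (u + w)) : ℤ) : ℚ), 0, 0⟩ → (W.minimalDiscriminantNorm ℤ : ℝ) ≤ |(((u ^ 6 * w ^ 2 * (u + w) ^ 3 * (9 * u + w) : ℤ)) : ℝ)| ∧ (UniqueFactorizationMonoid.radical (u * w * (u + w) * (9 * u + w))).natAbs ∣ 6 * W.conductorNorm ℤ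

-- `SixTorsionDictionary` holds: proved by `Summit.ABC.ABC.Theorems.sixTorsionDictionary_proof` (its module imports this route file, so no `_holds` link can be stated here).

/-- item stmt-ABC-24552 · support · rank 9 · closed · proved by Summit.ABC.ABC.Theorems.sixTorsionPayoff_proof (prover) · by planner
sources: StewartYu2001, SilvermanAEC2009
[support] PAYOFF (real-analysis glue): the pencil engine with (a₃,b₃,a₄,b₄) = (1,1,9,1) and the
dictionary give the class theorem: log|Δ_min| ≤ 12·log max(|u|,|w|) + log 10·… ≤ 12·C·(6
N_W)^(1/4+ε) + c ≤ C'·N_W^(1/4+ε) (N_W ≥ 1). [difficulty: provable-now] -/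
@[route_item "route-ABC-RationalCuspPencil", crux]
def SixTorsionPayoff : Prop :=
  PencilFourBound → SixTorsionDictionary → SixTorsionClassEpsShape

-- `SixTorsionPayoff` holds: proved by `Summit.ABC.ABC.Theorems.sixTorsionPayoff_proof` (its module imports this route file, so no `_holds` link can be stated here).

/-- item stmt-ABC-24553 · assembly · rank 1 · closed · proved by Summit.ABC.ABC.Theorems.rationalCuspPencil_assembly_proof (prover) · by planner
sources: StewartYu2001, Kubert1976
[assembly] PencilFourBound → SixTorsionDictionary → SixTorsionPayoff → SixTorsionResidual → abc
(pure logic; the deciding theorem `closes` in glue.lean is the certified form). -/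
@[route_item "route-ABC-RationalCuspPencil"]
def Assembly : Prop :=
  PencilFourBound → SixTorsionDictionary → SixTorsionPayoff → SixTorsionResidual → _root_.ABC

-- `Assembly` holds: proved by `Summit.ABC.ABC.Theorems.rationalCuspPencil_assembly_proof` (its module imports this route file, so no `_holds` link can be stated here).

/-! D-0027 §2.1 — DECIDING THEOREM (planner-authored via `route open/edit --closes-file`; by planner-abc-idea-1-g4-0 2026-08-28T01:51:07Z):
its hypotheses are this route's items and its conclusion the sub-problem Statement (glue_lint), and it elaborates with this file. -/

@[closes "route-ABC-RationalCuspPencil"] theorem closes (h₁ : PencilFourBound) (h₂ : SixTorsionDictionary) (h₃ : SixTorsionPayoff)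
    (h₄ : SixTorsionResidual) : _root_.ABC :=
  h₄ (h₃ h₁ h₂)

end Summit.ABC.ABC.Theses.RationalCuspPencil
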